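import Literature.NumberTheory.EllipticCurves.TwoAdicImageSurjectivity
import Literature.NumberTheory.EllipticCurves.BSDSelmerPConverseSerreProofs
import Literature.NumberTheory.GaloisRepresentations.ModEightLifting
import HarnessLib

/-!
# `ρ̄_{E,8}` onto ⟹ `ρ̄_{E,2ⁿ}` onto for every `n`: discharge of
# `hasSurjectiveModNGaloisRep_two_pow_of_eight`

Topic `NumberTheory/EllipticCurves`; theorem-only `Proofs` companion (D-0014 append protocol:
no definition, no named fact, no `sorry`) of
`Literature.NumberTheory.EllipticCurves.TwoAdicImageSurjectivity`, whose named fact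
`Literature.NumberTheory.EllipticCurves.hasSurjectiveModNGaloisRep_two_pow_of_eight` — for an
elliptic curve `W/ℚ`, if `ρ̄_{E,8} : Γ_ℚ → Aut(E[8])` is onto then `ρ̄_{E,2ⁿ} : Γ_ℚ → Aut(E[2ⁿ])`
is onto for every `n` (J. Rouse, D. Zureick-Brown, Res. Number Theory 1 (2015), §3 Lemma and §1;
T. Dokchitser, V. Dokchitser, Math. Z. 272 (2012), Introduction; A. Vasiu, Manuscripta Math. 112
(2003), Lemma 4.1.2 at `p = 2`) — is PROVED here: `hasSurjectiveModNGaloisRep_two_pow_of_eight_holds`.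

The GROUP THEORY is already in the tree at finite level
(`Literature.NumberTheory.GaloisRepresentations.surjective_of_surjective_castHom_eight_comp`,
`ModEightLifting.lean`: for `k ≥ 3` a homomorphism `ρ : G →* GL₂(ℤ/2ᵏ)` whose reduction modulo `8`
is onto is onto; cf. `RouseZureickBrown2015.generalLinearGroup_eq_top_of_map_surjective_two`).
What this file supplies is the ELLIPTIC-CURVE GLUE the fact's docstring names as missing
("`E[2ᴺ] ≅ (ℤ/2ᴺ)²` … and the compatibility of the `ρ̄_{2ᴺ}` under `E[2ᴺ] → E[8]`"), by
generalising, from level `p` to level `p^m`, the glue of the tree's discharge of Serre's `ℓ ≥ 5`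
lemma (`serre_hasSurjectiveModNGaloisRep_pow_holds`, `BSDSelmerPConverseSerreProofs.lean`):

* `exists_frame_torsion_of_frame_pow` — given a frame `e : E[p^{m+j}] ≃ (ℤ/p^{m+j})²` with matrix
  representation `ρ` (`e(σP) = ρ(σ)·e(P)`), the map `v ↦ e⁻¹(p^j ṽ)` is an additive isomorphism
  `g : (ℤ/p^m)² ≃ E[p^m]` with `σ·g(v) = g((ρ(σ) mod p^m)·v)` (Silverman *AEC* III.7:
  `E[p^m] = p^j E[p^{m+j}]`; bijective by `#E[p^m] = p^{2m}`, `card_torsionPoints_eq_sq_holds`);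
* `exists_map_eq_of_hasSurjectiveModNGaloisRep_pow` — UPWARD compatibility: if `ρ̄_{E,p^m}` is onto,
  every `t ∈ GL₂(ℤ/p^m)` is `ρ(σ) mod p^m` for some `σ`;
* `rep_surjective_of_hasSurjectiveModNGaloisRep`, `hasSurjectiveModNGaloisRep_of_rep_surjective` —
  at one level, "`ρ̄` onto `Aut E[N]`" ⟺ "the framed `ρ` onto `GL₂(ℤ/N)`";
* `generalLinearGroup_map_castHom_pow_surjective` — `GL₂(ℤ/p^{m+j}) → GL₂(ℤ/p^m)` is onto
  (`m ≥ 1`: lift the entries; a lift of a unit determinant is a unit);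
* `hasSurjectiveModNGaloisRep_pow_of_pow_add` — DOWNWARD: `ρ̄_{E,p^{m+j}}` onto ⟹ `ρ̄_{E,p^m}`
  onto (`m ≥ 1`);
* `hasSurjectiveModNGaloisRep_two_pow_of_eight_holds` — the discharge: `n = 0` (`E[1] = 0`),
  `n = 1, 2` downward from `8 = 2³`, `n ≥ 3` upward by the mod-`8` lifting theorem.

## References

* [RouseZureickbrown2015] J. Rouse, D. Zureick-Brown, *Elliptic curves over `ℚ` and `2`-adic
  images of Galois*, Res. Number Theory 1 (2015), §1 and §3 Lemma.
* [DokchitserDokchitserMathZ2012] T. Dokchitser, V. Dokchitser, *Surjectivity of mod `2ⁿ`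
  representations of elliptic curves*, Math. Z. 272 (2012) 961–964, Introduction.
* [Vasiu2003] A. Vasiu, *Surjectivity criteria for p-adic representations, Part I*, Manuscripta
  Math. 112 (2003) 325–355, Lemma 4.1.2.
* [SilvermanAEC2009] J. H. Silverman, *The Arithmetic of Elliptic Curves*, 2nd ed. (2009),
  III.6.4(b), III.7.
-/

noncomputable section

open scoped Classical MatrixGroups

open WeierstrassCurve Matrix

universe u

namespace Literature.NumberTheory.EllipticCurves

/-! ### Arithmetic in `ℤ/p^{m+j}ℤ` -/

/-- `p^j · p^m = 0` in `ℤ/p^{m+j}ℤ`. [folklore] -/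
private theorem pow_mul_pow_eq_zero (p m j : ℕ) :
    ((p : ZMod (p ^ (m + j))) ^ j * (p : ZMod (p ^ (m + j))) ^ m) = 0 := by
  rw [← pow_add, add_comm, ← Nat.cast_pow, ZMod.natCast_self]

/-- In `ℤ/p^{m+j}ℤ`: if `p^j b = 0` then `b` reduces to `0` modulo `p^m`. [folklore] -/
private theorem castHom_eq_zero_of_pow_mul_eq_zero {p : ℕ} (hp : p.Prime) (m j : ℕ)
    (b : ZMod (p ^ (m + j))) (h : (p : ZMod (p ^ (m + j))) ^ j * b = 0) :
    ZMod.castHom (pow_dvd_pow p (Nat.le_add_right m j)) (ZMod (p ^ m)) b = 0 := by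
  haveI : NeZero (p ^ (m + j)) := ⟨pow_ne_zero _ hp.ne_zero⟩
  rw [← ZMod.natCast_zmod_val b, ← Nat.cast_pow, ← Nat.cast_mul, ZMod.natCast_eq_zero_iff] at h
  have h1 : p ^ j * p ^ m ∣ p ^ j * b.val := by rwa [← pow_add, add_comm]
  have h2 : p ^ m ∣ b.val := Nat.dvd_of_mul_dvd_mul_left (pow_pos hp.pos j) h1
  rw [ZMod.castHom_apply, ZMod.cast_eq_val, ZMod.natCast_eq_zero_iff]
  exact h2

/-! ### The frame of `E[p^m]` induced by a frame of `E[p^{m+j}]` -/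

/-- **`E[p^m] = p^j E[p^{m+j}]`, framed (Silverman *AEC* III.7, III.6.4(b)).** Let
`e : E[p^{m+j}] ≃ (ℤ/p^{m+j})²` be an additive frame with matrix representation `ρ`
(`e (σ P) = ρ(σ) · e P`). Then `v ↦ e⁻¹(p^j ṽ)` (`ṽ` any lift of `v`) is an additive isomorphism
`g : (ℤ/p^m)² ≃ E[p^m]` — injective, and onto because `#E[p^m] = p^{2m}`
(`card_torsionPoints_eq_sq_holds`) — satisfying `σ • g(v) = g((ρ(σ) mod p^m) · v)`. (The case
`m + j = k + 1`, `m = 1` is the tree's `exists_map_eq_of_hasSurjectiveModNGaloisRep`.)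
[cite: SilvermanAEC2009, Cor. III.6.4(b) and §III.7] -/
theorem exists_frame_torsion_of_frame_pow {F : Type u} [Field F]
    (W : WeierstrassCurve F) [W.IsElliptic] (p m j : ℕ) [Fact p.Prime] (hpF : (p : F) ≠ 0)
    (e : geomTorsion W ((p ^ (m + j) : ℕ) : ℤ) ≃+ (Fin 2 → ZMod (p ^ (m + j))))
    (ρ : Field.absoluteGaloisGroup F →* GL (Fin 2) (ZMod (p ^ (m + j))))
    (hρ : ∀ (σ : Field.absoluteGaloisGroup F) (P : geomTorsion W ((p ^ (m + j) : ℕ) : ℤ)),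
      e (σ • P) = ((ρ σ : GL (Fin 2) (ZMod (p ^ (m + j)))) :
        Matrix (Fin 2) (Fin 2) (ZMod (p ^ (m + j)))) *ᵥ e P) :
    ∃ g : (Fin 2 → ZMod (p ^ m)) ≃+ geomTorsion W ((p ^ m : ℕ) : ℤ),
      ∀ (σ : Field.absoluteGaloisGroup F) (v : Fin 2 → ZMod (p ^ m)),
        σ • g v = g (((Matrix.GeneralLinearGroup.map
          (ZMod.castHom (pow_dvd_pow p (Nat.le_add_right m j)) (ZMod (p ^ m))) (ρ σ) :
            GL (Fin 2) (ZMod (p ^ m))) : Matrix (Fin 2) (Fin 2) (ZMod (p ^ m))) *ᵥ v) := by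
  have hp : p.Prime := Fact.out
  haveI : NeZero (p ^ (m + j)) := ⟨pow_ne_zero _ hp.ne_zero⟩
  haveI : NeZero (p ^ m) := ⟨pow_ne_zero _ hp.ne_zero⟩
  set R := ZMod (p ^ (m + j)) with hR
  set red : R →+* ZMod (p ^ m) :=
    ZMod.castHom (pow_dvd_pow p (Nat.le_add_right m j)) (ZMod (p ^ m)) with hred
  -- `θ : ℤ/p^m → ℤ/p^(m+j)`, `x ↦ p^j x̃`
  set f : ℤ →+ R := (AddMonoidHom.mulLeft ((p : R) ^ j)).comp (Int.castAddHom R) with hf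
  have hf_apply : ∀ x : ℤ, f x = (p : R) ^ j * (x : R) := fun x ↦ rfl
  have hf0 : f (p ^ m : ℕ) = 0 := by
    rw [hf_apply, Int.cast_natCast, Nat.cast_pow, pow_mul_pow_eq_zero]
  set θ : ZMod (p ^ m) →+ R := ZMod.lift (p ^ m) ⟨f, hf0⟩ with hθ
  have hθred : ∀ b : R, θ (red b) = (p : R) ^ j * b := fun b ↦ by
    rw [hred, ZMod.castHom_apply, ZMod.cast_eq_val, ← Int.cast_natCast, hθ, ZMod.lift_coe]
    change f _ = _
    rw [hf_apply, Int.cast_natCast, ZMod.natCast_zmod_val]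
  have hθmul : ∀ (a : R) (x : ZMod (p ^ m)), a * θ x = θ (red a * x) := fun a x ↦ by
    obtain ⟨b, rfl⟩ := ZMod.ringHom_surjective red x
    rw [← map_mul, hθred, hθred]
    ring
  have hθp : ∀ x : ZMod (p ^ m), (p ^ m) • θ x = 0 := fun x ↦ by
    obtain ⟨b, rfl⟩ := ZMod.ringHom_surjective red x
    rw [hθred, nsmul_eq_mul, ← mul_assoc, Nat.cast_pow, mul_comm ((p : R) ^ m),
      pow_mul_pow_eq_zero, zero_mul]
  have hθinj : ∀ x : ZMod (p ^ m), θ x = 0 → x = 0 := fun x hx ↦ by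
    obtain ⟨b, rfl⟩ := ZMod.ringHom_surjective red x
    rw [hθred] at hx
    exact castHom_eq_zero_of_pow_mul_eq_zero hp m j b hx
  -- the injection `g : (ℤ/p^m)² → E[p^m]`, `v ↦ e⁻¹ (θ ∘ v)`
  set lift : (Fin 2 → ZMod (p ^ m)) → geomTorsion W ((p ^ (m + j) : ℕ) : ℤ) :=
    fun v ↦ e.symm (fun i ↦ θ (v i)) with hlift
  have hlift_mem : ∀ v, ((lift v : geomTorsion W ((p ^ (m + j) : ℕ) : ℤ)) : geomPoints W) ∈
      geomTorsion W ((p ^ m : ℕ) : ℤ) := fun v ↦ by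
    rw [AddSubgroup.torsionBy.nsmul_iff, ← AddSubmonoidClass.coe_nsmul, hlift, ← map_nsmul]
    have : (p ^ m) • (fun i ↦ θ (v i)) = 0 := funext fun i ↦ by
      rw [Pi.smul_apply, hθp, Pi.zero_apply]
    rw [this, map_zero]
    rfl
  set g : (Fin 2 → ZMod (p ^ m)) →+ geomTorsion W ((p ^ m : ℕ) : ℤ) :=
    { toFun := fun v ↦ ⟨_, hlift_mem v⟩
      map_zero' := by
        apply Subtype.ext
        change ((e.symm fun i ↦ θ ((0 : Fin 2 → ZMod (p ^ m)) i) :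
          geomTorsion W ((p ^ (m + j) : ℕ) : ℤ)) : geomPoints W) = 0
        have : (fun i ↦ θ ((0 : Fin 2 → ZMod (p ^ m)) i)) = 0 := funext fun i ↦ by
          rw [Pi.zero_apply, map_zero, Pi.zero_apply]
        rw [this, map_zero]
        rfl
      map_add' := fun v w ↦ by
        apply Subtype.ext
        change ((e.symm fun i ↦ θ ((v + w) i) : geomTorsion W ((p ^ (m + j) : ℕ) : ℤ)) :
            geomPoints W) =
          ((e.symm fun i ↦ θ (v i) : geomTorsion W ((p ^ (m + j) : ℕ) : ℤ)) : geomPoints W) +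
            ((e.symm fun i ↦ θ (w i) : geomTorsion W ((p ^ (m + j) : ℕ) : ℤ)) : geomPoints W)
        have : (fun i ↦ θ ((v + w) i)) = (fun i ↦ θ (v i)) + fun i ↦ θ (w i) :=
          funext fun i ↦ by rw [Pi.add_apply, map_add, Pi.add_apply]
        rw [this, map_add, AddSubgroup.coe_add] } with hg
  have hg_coe : ∀ v, ((g v : geomTorsion W ((p ^ m : ℕ) : ℤ)) : geomPoints W) =
      (lift v : geomPoints W) := fun v ↦ rfl
  have hginj : Function.Injective g := by
    refine (injective_iff_map_eq_zero g).mpr fun v hv ↦ ?_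
    have h1 : ((lift v : geomTorsion W ((p ^ (m + j) : ℕ) : ℤ)) : geomPoints W) = 0 := by
      rw [← hg_coe, hv]; rfl
    have h2 : lift v = 0 := by exact_mod_cast h1
    rw [hlift, ← map_zero e.symm] at h2
    have h3 := e.symm.injective h2
    funext i
    exact hθinj _ (congrFun h3 i)
  -- `g` is a bijection, `#E[p^m] = p^{2m}`
  have hpF' : ((p ^ m : ℕ) : AlgebraicClosure F) ≠ 0 := fun h0 ↦ hpF <| by
    apply (algebraMap F (AlgebraicClosure F)).injective
    have h1 : ((p : AlgebraicClosure F)) ^ m = 0 := by rwa [Nat.cast_pow] at h0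
    rw [map_natCast, map_zero, pow_eq_zero_iff'.mp h1 |>.1]
  have hcard1 : Nat.card (geomTorsion W ((p ^ m : ℕ) : ℤ)) = (p ^ m) ^ 2 :=
    card_torsionPoints_eq_sq_holds W (AlgebraicClosure F) hpF'
  haveI : Finite (geomTorsion W ((p ^ m : ℕ) : ℤ)) :=
    Nat.finite_of_card_ne_zero (by rw [hcard1]; exact pow_ne_zero _ (pow_ne_zero _ hp.ne_zero))
  have hbij : Function.Bijective g := hginj.bijective_of_nat_card_le (by
    rw [hcard1, Nat.card_fun, Nat.card_zmod, Nat.card_eq_fintype_card, Fintype.card_fin])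
  set gE : (Fin 2 → ZMod (p ^ m)) ≃+ geomTorsion W ((p ^ m : ℕ) : ℤ) :=
    AddEquiv.ofBijective g hbij with hgE
  refine ⟨gE, fun σ v ↦ ?_⟩
  -- equivariance: `σ • g v = g ((ρ σ mod p^m) v)`
  have hgv : ∀ v, gE v = g v := fun v ↦ AddEquiv.ofBijective_apply g hbij v
  rw [hgv, hgv]
  apply Subtype.ext
  rw [AddSubgroup.torsionBy.coe_smul, hg_coe, hg_coe, ← AddSubgroup.torsionBy.coe_smul]
  have h1 : σ • lift v = e.symm (((ρ σ : GL (Fin 2) R) : Matrix (Fin 2) (Fin 2) R) *ᵥ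
      fun i ↦ θ (v i)) := by
    have := congrArg e.symm (hρ σ (lift v))
    rwa [e.symm_apply_apply, hlift, e.apply_symm_apply] at this
  have h2 : (((ρ σ : GL (Fin 2) R) : Matrix (Fin 2) (Fin 2) R) *ᵥ fun i ↦ θ (v i)) =
      fun i ↦ θ ((((Matrix.GeneralLinearGroup.map red (ρ σ) : GL (Fin 2) (ZMod (p ^ m))) :
        Matrix (Fin 2) (Fin 2) (ZMod (p ^ m))) *ᵥ v) i) := by
    have hmap : ∀ i i', ((Matrix.GeneralLinearGroup.map red (ρ σ) : GL (Fin 2) (ZMod (p ^ m))) :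
        Matrix (Fin 2) (Fin 2) (ZMod (p ^ m))) i i' = red (((ρ σ : GL (Fin 2) R) :
          Matrix (Fin 2) (Fin 2) R) i i') := fun i i' ↦ rfl
    funext i
    simp only [Matrix.mulVec, dotProduct, Fin.sum_univ_two, map_add, hmap, ← hθmul]
  rw [h1, h2]

/-! ### Upward compatibility: `ρ̄_{E,p^m}` onto ⟹ the framed `ρ` on `E[p^{m+j}]` maps onto `GL₂(ℤ/p^m)` -/

/-- **Compatibility of the framed representation on `E[p^{m+j}]` with `E[p^m] ⊂ E[p^{m+j}]`.**
With `e`, `ρ` as in `exists_frame_torsion_of_frame_pow`: if `ρ̄_{E,p^m} : Γ_F → Aut E[p^m]` is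
onto, every `t ∈ GL₂(ℤ/p^m)` is the reduction modulo `p^m` of some `ρ(σ)` (transport `t` to
`Aut E[p^m]` along the induced frame `g`, lift it to `σ`, compare). (Silverman *AEC* III.7.)
[cite: SilvermanAEC2009, §III.7] -/
theorem exists_map_eq_of_hasSurjectiveModNGaloisRep_pow {F : Type u} [Field F]
    (W : WeierstrassCurve F) [W.IsElliptic] (p m j : ℕ) [Fact p.Prime] (hpF : (p : F) ≠ 0)
    (e : geomTorsion W ((p ^ (m + j) : ℕ) : ℤ) ≃+ (Fin 2 → ZMod (p ^ (m + j))))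
    (ρ : Field.absoluteGaloisGroup F →* GL (Fin 2) (ZMod (p ^ (m + j))))
    (hρ : ∀ (σ : Field.absoluteGaloisGroup F) (P : geomTorsion W ((p ^ (m + j) : ℕ) : ℤ)),
      e (σ • P) = ((ρ σ : GL (Fin 2) (ZMod (p ^ (m + j)))) :
        Matrix (Fin 2) (Fin 2) (ZMod (p ^ (m + j)))) *ᵥ e P)
    (hsurj : W.HasSurjectiveModNGaloisRep ((p ^ m : ℕ) : ℤ)) (t : GL (Fin 2) (ZMod (p ^ m))) :
    ∃ σ : Field.absoluteGaloisGroup F,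
      Matrix.GeneralLinearGroup.map
        (ZMod.castHom (pow_dvd_pow p (Nat.le_add_right m j)) (ZMod (p ^ m))) (ρ σ) = t := by
  obtain ⟨gE, hequiv⟩ := exists_frame_torsion_of_frame_pow W p m j hpF e ρ hρ
  set red : ZMod (p ^ (m + j)) →+* ZMod (p ^ m) :=
    ZMod.castHom (pow_dvd_pow p (Nat.le_add_right m j)) (ZMod (p ^ m)) with hred
  -- transport `t` to an automorphism of `E[p^m]` and lift it to `Γ_F`
  set tE : (Fin 2 → ZMod (p ^ m)) ≃+ (Fin 2 → ZMod (p ^ m)) :=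
    { toFun := fun v ↦ (t : Matrix (Fin 2) (Fin 2) (ZMod (p ^ m))) *ᵥ v
      invFun := fun v ↦ ((t⁻¹ : GL (Fin 2) (ZMod (p ^ m))) :
        Matrix (Fin 2) (Fin 2) (ZMod (p ^ m))) *ᵥ v
      left_inv := fun v ↦ by
        change ((t⁻¹ : GL (Fin 2) (ZMod (p ^ m))) : Matrix (Fin 2) (Fin 2) (ZMod (p ^ m))) *ᵥ
          ((t : Matrix (Fin 2) (Fin 2) (ZMod (p ^ m))) *ᵥ v) = v
        rw [Matrix.mulVec_mulVec, ← Matrix.GeneralLinearGroup.coe_mul, inv_mul_cancel,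
          Matrix.GeneralLinearGroup.coe_one, Matrix.one_mulVec]
      right_inv := fun v ↦ by
        change (t : Matrix (Fin 2) (Fin 2) (ZMod (p ^ m))) *ᵥ
          (((t⁻¹ : GL (Fin 2) (ZMod (p ^ m))) : Matrix (Fin 2) (Fin 2) (ZMod (p ^ m))) *ᵥ v) = v
        rw [Matrix.mulVec_mulVec, ← Matrix.GeneralLinearGroup.coe_mul, mul_inv_cancel,
          Matrix.GeneralLinearGroup.coe_one, Matrix.one_mulVec]
      map_add' := fun v w ↦ Matrix.mulVec_add _ _ _ } with htE
  set ft : geomTorsion W ((p ^ m : ℕ) : ℤ) ≃+ geomTorsion W ((p ^ m : ℕ) : ℤ) :=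
    (gE.symm.trans tE).trans gE with hft
  obtain ⟨σ, hσ⟩ := hsurj (Multiplicative.ofAdd ft)
  have hσP : ∀ P : geomTorsion W ((p ^ m : ℕ) : ℤ), σ • P = ft P := fun P ↦ by
    rw [← galoisRepTorsion_apply W ((p ^ m : ℕ) : ℤ) σ P, hσ]
    rfl
  refine ⟨σ, Units.ext (Matrix.ext fun i i' ↦ ?_)⟩
  have hv : ∀ v : Fin 2 → ZMod (p ^ m),
      ((Matrix.GeneralLinearGroup.map red (ρ σ) : GL (Fin 2) (ZMod (p ^ m))) :
        Matrix (Fin 2) (Fin 2) (ZMod (p ^ m))) *ᵥ v =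
          (t : Matrix (Fin 2) (Fin 2) (ZMod (p ^ m))) *ᵥ v := by
    intro v
    apply gE.injective
    rw [← hequiv, hσP, hft, AddEquiv.trans_apply, AddEquiv.trans_apply, AddEquiv.symm_apply_apply]
    rfl
  have := congrFun (hv (Pi.single i' 1)) i
  rwa [Matrix.mulVec_single_one, Matrix.mulVec_single_one] at this

/-! ### At one level: `ρ̄` onto `Aut E[N]` versus the framed `ρ` onto `GL₂(ℤ/N)` -/

/-- **If `ρ̄_{E,N} : Γ_F → Aut(E[N])` is onto, the framed representation `ρ : Γ_F → GL₂(ℤ/N)` is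
onto**: a matrix `B` defines the additive automorphism `e⁻¹ ∘ B ∘ e`, which is some `σ`.
[cite: SilvermanAEC2009, §III.7] -/
theorem rep_surjective_of_hasSurjectiveModNGaloisRep {F : Type u} [Field F]
    (W : WeierstrassCurve F) {N : ℕ} (e : geomTorsion W (N : ℤ) ≃+ (Fin 2 → ZMod N))
    (ρ : Field.absoluteGaloisGroup F →* GL (Fin 2) (ZMod N))
    (hρ : ∀ (σ : Field.absoluteGaloisGroup F) (P : geomTorsion W (N : ℤ)),
      e (σ • P) = ((ρ σ : GL (Fin 2) (ZMod N)) : Matrix (Fin 2) (Fin 2) (ZMod N)) *ᵥ e P)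
    (hsurj : W.HasSurjectiveModNGaloisRep (N : ℤ)) : Function.Surjective ρ := by
  intro B
  set tB : (Fin 2 → ZMod N) ≃+ (Fin 2 → ZMod N) :=
    { toFun := fun v ↦ (B : Matrix (Fin 2) (Fin 2) (ZMod N)) *ᵥ v
      invFun := fun v ↦ ((B⁻¹ : GL (Fin 2) (ZMod N)) : Matrix (Fin 2) (Fin 2) (ZMod N)) *ᵥ v
      left_inv := fun v ↦ by
        change ((B⁻¹ : GL (Fin 2) (ZMod N)) : Matrix (Fin 2) (Fin 2) (ZMod N)) *ᵥ
          ((B : Matrix (Fin 2) (Fin 2) (ZMod N)) *ᵥ v) = v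
        rw [Matrix.mulVec_mulVec, ← Matrix.GeneralLinearGroup.coe_mul, inv_mul_cancel,
          Matrix.GeneralLinearGroup.coe_one, Matrix.one_mulVec]
      right_inv := fun v ↦ by
        change (B : Matrix (Fin 2) (Fin 2) (ZMod N)) *ᵥ
          (((B⁻¹ : GL (Fin 2) (ZMod N)) : Matrix (Fin 2) (Fin 2) (ZMod N)) *ᵥ v) = v
        rw [Matrix.mulVec_mulVec, ← Matrix.GeneralLinearGroup.coe_mul, mul_inv_cancel,
          Matrix.GeneralLinearGroup.coe_one, Matrix.one_mulVec]
      map_add' := fun v w ↦ Matrix.mulVec_add _ _ _ } with htB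
  set fB : geomTorsion W (N : ℤ) ≃+ geomTorsion W (N : ℤ) := (e.trans tB).trans e.symm with hfB
  obtain ⟨σ, hσ⟩ := hsurj (Multiplicative.ofAdd fB)
  have hσP : ∀ P : geomTorsion W (N : ℤ), σ • P = fB P := fun P ↦ by
    rw [← galoisRepTorsion_apply W (N : ℤ) σ P, hσ]
    rfl
  refine ⟨σ, Units.ext (Matrix.ext fun i i' ↦ ?_)⟩
  have hv : ∀ v : Fin 2 → ZMod N,
      ((ρ σ : GL (Fin 2) (ZMod N)) : Matrix (Fin 2) (Fin 2) (ZMod N)) *ᵥ v =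
        (B : Matrix (Fin 2) (Fin 2) (ZMod N)) *ᵥ v := by
    intro v
    obtain ⟨P, rfl⟩ := e.surjective v
    rw [← hρ σ P, hσP, hfB, AddEquiv.trans_apply, AddEquiv.trans_apply, e.apply_symm_apply]
    rfl
  have := congrFun (hv (Pi.single i' 1)) i
  rwa [Matrix.mulVec_single_one, Matrix.mulVec_single_one] at this

/-- **If the framed representation `ρ : Γ_F → GL₂(ℤ/N)` is onto, then `ρ̄_{E,N} : Γ_F → Aut(E[N])`
is onto**: every additive automorphism of `E[N]` has an invertible matrix in the frame
(`exists_matrix_of_addEquiv`, `exists_generalLinearGroup_of_addEquiv`), which is some `ρ(σ)`.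
[cite: SilvermanAEC2009, §III.7] -/
theorem hasSurjectiveModNGaloisRep_of_rep_surjective {F : Type u} [Field F]
    (W : WeierstrassCurve F) {N : ℕ} (e : geomTorsion W (N : ℤ) ≃+ (Fin 2 → ZMod N))
    (ρ : Field.absoluteGaloisGroup F →* GL (Fin 2) (ZMod N))
    (hρ : ∀ (σ : Field.absoluteGaloisGroup F) (P : geomTorsion W (N : ℤ)),
      e (σ • P) = ((ρ σ : GL (Fin 2) (ZMod N)) : Matrix (Fin 2) (Fin 2) (ZMod N)) *ᵥ e P)
    (hρsurj : Function.Surjective ρ) : W.HasSurjectiveModNGaloisRep (N : ℤ) := by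
  intro y
  obtain ⟨Φ, hΦ⟩ := exists_matrix_of_addEquiv e
  obtain ⟨B, hB⟩ := exists_generalLinearGroup_of_addEquiv Φ (Multiplicative.toAdd y)
  obtain ⟨σ, hσ⟩ := hρsurj B
  refine ⟨σ, Multiplicative.toAdd.injective (AddEquiv.ext fun P ↦ e.injective ?_)⟩
  rw [galoisRepTorsion_apply, hρ σ P, hσ, hB]
  exact (hΦ _ P).symm

/-! ### Reduction `GL₂(ℤ/p^{m+j}) → GL₂(ℤ/p^m)` is onto -/

/-- **Reduction of invertible matrices `GL₂(ℤ/p^{m+j}ℤ) → GL₂(ℤ/p^mℤ)` is onto** (`m ≥ 1`): lift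
the entries; the determinant of the lift reduces to a unit, and an element of `ℤ/p^{m+j}ℤ` whose
reduction modulo `p^m` (`m ≥ 1`) is a unit is a unit (both mean "prime to `p`",
`ZMod.isUnit_natCast_iff_not_dvd_pow`). [folklore] -/
private theorem generalLinearGroup_map_castHom_pow_surjective {p : ℕ} (hp : p.Prime) {m : ℕ}
    (hm : 0 < m) (j : ℕ) (t : GL (Fin 2) (ZMod (p ^ m))) :
    ∃ T : GL (Fin 2) (ZMod (p ^ (m + j))),
      Matrix.GeneralLinearGroup.map
        (ZMod.castHom (pow_dvd_pow p (Nat.le_add_right m j)) (ZMod (p ^ m))) T = t := by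
  haveI : NeZero (p ^ (m + j)) := ⟨pow_ne_zero _ hp.ne_zero⟩
  haveI : NeZero (p ^ m) := ⟨pow_ne_zero _ hp.ne_zero⟩
  set red : ZMod (p ^ (m + j)) →+* ZMod (p ^ m) :=
    ZMod.castHom (pow_dvd_pow p (Nat.le_add_right m j)) (ZMod (p ^ m)) with hred
  -- lift the entries
  set M : Matrix (Fin 2) (Fin 2) (ZMod (p ^ (m + j))) :=
    fun i i' ↦ (((t : Matrix (Fin 2) (Fin 2) (ZMod (p ^ m))) i i').val : ZMod (p ^ (m + j)))
    with hM
  have hMred : M.map red = (t : Matrix (Fin 2) (Fin 2) (ZMod (p ^ m))) := by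
    ext i i'
    rw [Matrix.map_apply, hM]
    change red (((t : Matrix (Fin 2) (Fin 2) (ZMod (p ^ m))) i i').val : ZMod (p ^ (m + j))) = _
    rw [map_natCast, ZMod.natCast_zmod_val]
  -- the determinant of the lift is a unit
  have hdet : IsUnit M.det := by
    have hred_det : red M.det = (t : Matrix (Fin 2) (Fin 2) (ZMod (p ^ m))).det := by
      rw [RingHom.map_det, RingHom.mapMatrix_apply, hMred]
    have hu : IsUnit (red M.det) := by
      rw [hred_det, ← Matrix.GeneralLinearGroup.val_det_apply]
      exact Units.isUnit _
    rw [← ZMod.natCast_zmod_val M.det] at hu ⊢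
    rw [map_natCast, ZMod.isUnit_natCast_iff_not_dvd_pow hp hm] at hu
    exact (ZMod.isUnit_natCast_iff_not_dvd_pow hp (Nat.add_pos_left hm j)).mpr hu
  obtain ⟨T, hT⟩ : ∃ T : GL (Fin 2) (ZMod (p ^ (m + j))),
      (T : Matrix (Fin 2) (Fin 2) (ZMod (p ^ (m + j)))) = M :=
    ⟨((Matrix.isUnit_iff_isUnit_det M).mpr hdet).unit, IsUnit.unit_spec _⟩
  refine ⟨T, Units.ext ?_⟩
  rw [← hMred, ← hT]
  rfl

/-! ### Downward: `ρ̄_{E,p^{m+j}}` onto ⟹ `ρ̄_{E,p^m}` onto -/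

/-- **`ρ̄_{E,p^{m+j}}` onto ⟹ `ρ̄_{E,p^m}` onto** (`m ≥ 1`, `p` invertible in `F`): frame
`E[p^{m+j}] ≅ (ℤ/p^{m+j})²` (`nonempty_addEquiv_geomTorsion`) with matrix representation `ρ`
(`exists_rep_of_addEquiv`), onto `GL₂(ℤ/p^{m+j})` (`rep_surjective_of_hasSurjectiveModNGaloisRep`);
the induced frame `g` of `E[p^m]` (`exists_frame_torsion_of_frame_pow`) turns `σ` into
`ρ(σ) mod p^m`; an additive automorphism `y` of `E[p^m]` has an invertible matrix `t` in the frame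
`g`, a lift `T` of `t` (`generalLinearGroup_map_castHom_pow_surjective`) is `ρ(σ)`, and then
`σ` acts on `E[p^m]` as `y`. [cite: SilvermanAEC2009, Cor. III.6.4(b) and §III.7] -/
theorem hasSurjectiveModNGaloisRep_pow_of_pow_add {F : Type u} [Field F]
    (W : WeierstrassCurve F) [W.IsElliptic] (p m j : ℕ) [Fact p.Prime] (hm : 0 < m)
    (hpF : (p : F) ≠ 0) (hsurj : W.HasSurjectiveModNGaloisRep ((p ^ (m + j) : ℕ) : ℤ)) :
    W.HasSurjectiveModNGaloisRep ((p ^ m : ℕ) : ℤ) := by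
  have hp : p.Prime := Fact.out
  obtain ⟨e⟩ := nonempty_addEquiv_geomTorsion W p (m + j) (Nat.add_pos_left hm j) hpF
  obtain ⟨ρ, hρ⟩ := exists_rep_of_addEquiv W e
  have hρsurj := rep_surjective_of_hasSurjectiveModNGaloisRep W e ρ hρ hsurj
  obtain ⟨gE, hequiv⟩ := exists_frame_torsion_of_frame_pow W p m j hpF e ρ hρ
  set red : ZMod (p ^ (m + j)) →+* ZMod (p ^ m) :=
    ZMod.castHom (pow_dvd_pow p (Nat.le_add_right m j)) (ZMod (p ^ m)) with hred
  intro y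
  -- the matrix `t` of `y` in the frame `gE.symm`
  obtain ⟨Φ, hΦ⟩ := exists_matrix_of_addEquiv gE.symm
  obtain ⟨t, ht⟩ := exists_generalLinearGroup_of_addEquiv Φ (Multiplicative.toAdd y)
  obtain ⟨T, hT⟩ := generalLinearGroup_map_castHom_pow_surjective hp hm j t
  obtain ⟨σ, hσ⟩ := hρsurj T
  refine ⟨σ, Multiplicative.toAdd.injective (AddEquiv.ext fun P ↦ ?_)⟩
  obtain ⟨v, rfl⟩ := gE.surjective P
  rw [galoisRepTorsion_apply, hequiv σ v, hσ, hT, ht]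
  apply gE.symm.injective
  have h := (hΦ ((Multiplicative.toAdd y : AddAut (geomTorsion W ((p ^ m : ℕ) : ℤ))) :
      geomTorsion W ((p ^ m : ℕ) : ℤ) →+ geomTorsion W ((p ^ m : ℕ) : ℤ)) (gE v)).symm
  rw [gE.symm_apply_apply] at h
  rw [gE.symm_apply_apply]
  exact h

/-! ### The discharge -/

/-- **Discharge of `hasSurjectiveModNGaloisRep_two_pow_of_eight`** (Rouse–Zureick-Brown 2015 §3
Lemma / §1; Dokchitser–Dokchitser 2012, Introduction; Vasiu 2003 Lemma 4.1.2): for an elliptic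
curve `W/ℚ`, if `ρ̄_{E,8}` is onto then `ρ̄_{E,2ⁿ}` is onto for every `n`. Proof: `n = 0`:
`E[1] = 0`; `n = 1, 2`: downward from `8 = 2³` (`hasSurjectiveModNGaloisRep_pow_of_pow_add`);
`n ≥ 3`: frame `E[2ⁿ] ≅ (ℤ/2ⁿ)²`, the framed `ρ` maps onto `GL₂(ℤ/8)`
(`exists_map_eq_of_hasSurjectiveModNGaloisRep_pow`), hence is onto by the mod-`8` lifting theorem
(`GaloisRepresentations.surjective_of_surjective_castHom_eight_comp`), hence `ρ̄_{E,2ⁿ}` is onto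
(`hasSurjectiveModNGaloisRep_of_rep_surjective`).
[cite: RouseZureickbrown2015, §3 Lemma (maximal subgroups ⊇ Γ(2^(k+1))) and §1]
[cite: DokchitserDokchitserMathZ2012, Introduction (p. 961)] -/
theorem hasSurjectiveModNGaloisRep_two_pow_of_eight_holds :
    hasSurjectiveModNGaloisRep_two_pow_of_eight := by
  intro W _ h8 n
  haveI : Fact (Nat.Prime 2) := ⟨Nat.prime_two⟩
  have h2Q : ((2 : ℕ) : ℚ) ≠ 0 := by norm_num
  have hcast : (((2 ^ n : ℕ) : ℤ)) = (2 : ℤ) ^ n := by push_cast; rfl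
  rw [← hcast]
  have h8' : W.HasSurjectiveModNGaloisRep ((2 ^ 3 : ℕ) : ℤ) := by exact_mod_cast h8
  rcases Nat.lt_or_ge n 3 with hn | hn
  · interval_cases n
    · -- `n = 0`: `E[1] = 0`
      haveI : Subsingleton (geomTorsion W ((2 ^ 0 : ℕ) : ℤ)) := ⟨fun a b ↦ by
        have ha := AddSubgroup.torsionBy.nsmul_iff.mp a.2
        have hb := AddSubgroup.torsionBy.nsmul_iff.mp b.2
        simp only [pow_zero, one_smul] at ha hb
        exact Subtype.ext (ha.trans hb.symm)⟩
      intro y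
      exact ⟨1, Multiplicative.toAdd.injective (AddEquiv.ext fun a ↦ Subsingleton.elim _ _)⟩
    · -- `n = 1`: downward from `2^(1+2) = 8`
      exact hasSurjectiveModNGaloisRep_pow_of_pow_add W 2 1 2 one_pos h2Q h8'
    · -- `n = 2`: downward from `2^(2+1) = 8`
      exact hasSurjectiveModNGaloisRep_pow_of_pow_add W 2 2 1 two_pos h2Q h8'
  · -- `n ≥ 3`: upward by the mod-`8` lifting theorem
    obtain ⟨j, rfl⟩ : ∃ j, n = 3 + j := ⟨n - 3, by omega⟩
    obtain ⟨e⟩ := nonempty_addEquiv_geomTorsion W 2 (3 + j) (by omega) h2Q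
    obtain ⟨ρ, hρ⟩ := exists_rep_of_addEquiv W e
    have hρsurj : Function.Surjective ρ := by
      refine GaloisRepresentations.surjective_of_surjective_castHom_eight_comp hn ρ (fun t ↦ ?_)
      obtain ⟨σ, hσ⟩ := exists_map_eq_of_hasSurjectiveModNGaloisRep_pow W 2 3 j h2Q e ρ hρ h8' t
      exact ⟨σ, hσ⟩
    exact hasSurjectiveModNGaloisRep_of_rep_surjective W e ρ hρ hρsurj

end Literature.NumberTheory.EllipticCurves

end
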